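import Literature.MathematicalPhysics.QuantumFieldTheory.QCDTransferMatrix

/-!
# Positivity of the spin-blind Wilson slice operator `A(U) = diag(m_f + 4) − ½Σ_j (W_j + W_j†)`
(helper for crux stmt-QuantumFields-9737 `QuarksAsStableAction.StableActionBridge`, line `Sketch`;
stub `sliceMassHop_posDef`)

Smit's spin-blind slice operator `A(U)` (Lüscher's `B`) of `r = 1` Wilson quarks on one time slice,
`sliceMassHop U mq = diag(m_f + 4) − ½ Σ_{j<3} (W_j + W_jᴴ)` on `flavour × (site × colour)`, is
Hermitian positive definite for every `SU(3)` background `U`, every torus side `S ≥ 1` and all bare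
masses `m_f > −1` (hopping parameters `κ_f = 1/(2m_f + 8) < 1/6`, Montvay–Münster (4.111)).

Proof (sum of squares, no Cauchy–Schwarz): each forward colour hop `W_j = colourHop U j` is a
permutation-times-unitary matrix, hence an isometry, `W_jᴴ W_j = 1`, so that
`½ (1 − W_j)ᴴ (1 − W_j) = 1 − ½ (W_j + W_jᴴ)` and
`A(U) = diag(m_f + 4 − 3) + ½ Σ_j (1 − W_j)ᴴ (1 − W_j)`
is a positive definite real diagonal matrix plus a positive semidefinite one.
[cite: Luscher1977, pp. 283–292]; [cite: MontvayMunster1994, §4.2.3 (4.111)];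
prose: Smit, *Introduction to Quantum Fields on a Lattice* (2023), §6.5 (6.74), (6.85)–(6.86).
Pure theorem file (no definitions).
-/

noncomputable section

namespace Summit.QuantumFields.QCD.Cruxes.StableActionBridge.Sketch

open scoped ComplexOrder
open Literature.MathematicalPhysics.QuantumFieldTheory Literature.MathematicalPhysics.QuantumLattice
open Literature.Probability.LatticeModels (TorusSite)

namespace SliceMassHopPosDef

open Matrix

/-! ### Abstract part: mass-plus-hopping operators with isometric hops -/

section Abstract

variable {n ι : Type*} [Fintype n] [DecidableEq n] [Fintype ι]

/-- For an isometry `H` (`Hᴴ H = 1`): `(1 − H)ᴴ (1 − H) = 2·1 − (H + Hᴴ)`. -/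
theorem conjTranspose_one_sub_mul_one_sub (H : Matrix n n ℂ) (hH : Hᴴ * H = 1) :
    (1 - H)ᴴ * (1 - H) = (1 + 1) - (H + Hᴴ) := by
  rw [conjTranspose_sub, conjTranspose_one, sub_mul, one_mul, mul_sub, mul_one, hH]
  abel

/-- **Sum-of-squares form of a mass-plus-hopping operator** with isometric hops `H_j`
(`H_jᴴ H_j = 1`, `j : ι`) and real masses `d`:
`diag(d) − ½ Σ_j (H_j + H_jᴴ) = diag(d − |ι|) + ½ Σ_j (1 − H_j)ᴴ (1 − H_j)`. -/
theorem diagonal_sub_hopSum_eq (H : ι → Matrix n n ℂ) (hiso : ∀ j, (H j)ᴴ * H j = 1)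
    (d : n → ℝ) :
    Matrix.diagonal (fun v => ((d v : ℝ) : ℂ)) - (1 / 2 : ℂ) • ∑ j, (H j + (H j)ᴴ) =
      Matrix.diagonal (fun v => ((d v - Fintype.card ι : ℝ) : ℂ)) +
        (1 / 2 : ℂ) • ∑ j, (1 - H j)ᴴ * (1 - H j) := by
  have hdiag : Matrix.diagonal (fun v => ((d v - Fintype.card ι : ℝ) : ℂ)) =
      Matrix.diagonal (fun v => ((d v : ℝ) : ℂ)) - ∑ _j : ι, (1 : Matrix n n ℂ) := by
    ext a b
    rw [Finset.sum_const, Finset.card_univ, Matrix.sub_apply, Matrix.smul_apply, diagonal_apply,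
      diagonal_apply, one_apply]
    split_ifs
    · rw [Complex.ofReal_sub, Complex.ofReal_natCast, nsmul_eq_mul, mul_one]
    · rw [smul_zero, sub_zero]
  have hsq : ∀ j, (1 - H j)ᴴ * (1 - H j) = (1 + 1) - (H j + (H j)ᴴ) := fun j =>
    conjTranspose_one_sub_mul_one_sub (H j) (hiso j)
  simp only [hsq]
  rw [hdiag]
  simp only [Finset.sum_sub_distrib, Finset.sum_add_distrib, smul_sub, smul_add]
  module

/-- **Positivity of a mass-plus-hopping operator**: for isometric hops `H_j` (`H_jᴴ H_j = 1`)
indexed by `ι` and real masses `d_v > |ι|`, the matrix `diag(d) − ½ Σ_j (H_j + H_jᴴ)` is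
(Hermitian and) positive definite: it is `diag(d − |ι|) + ½ Σ_j (1 − H_j)ᴴ (1 − H_j)`. -/
theorem posDef_diagonal_sub_hopSum (H : ι → Matrix n n ℂ) (hiso : ∀ j, (H j)ᴴ * H j = 1)
    (d : n → ℝ) (hd : ∀ v, (Fintype.card ι : ℝ) < d v) :
    (Matrix.diagonal (fun v => ((d v : ℝ) : ℂ)) - (1 / 2 : ℂ) • ∑ j, (H j + (H j)ᴴ)).PosDef := by
  have hhalf : (0 : ℂ) ≤ 1 / 2 := by
    rw [show (1 / 2 : ℂ) = ((1 / 2 : ℝ) : ℂ) by norm_num]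
    exact Complex.zero_le_real.2 (by norm_num)
  rw [diagonal_sub_hopSum_eq H hiso d]
  refine PosDef.add_posSemidef (PosDef.diagonal fun v => ?_)
    (PosSemidef.smul (posSemidef_sum _ fun j _ => posSemidef_conjTranspose_mul_self (1 - H j))
      hhalf)
  exact Complex.zero_lt_real.2 (sub_pos.2 (hd v))

end Abstract

/-! ### The colour hops of `sliceMassHop` are isometries -/

section Hops

variable {Nf S : ℕ} [NeZero S]

/-- A special unitary link matrix is a co-isometry: `g gᴴ = 1`. -/
theorem link_mul_conjTranspose (g : Matrix.specialUnitaryGroup (Fin 3) ℂ) :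
    (g : Matrix (Fin 3) (Fin 3) ℂ) * (g : Matrix (Fin 3) (Fin 3) ℂ)ᴴ = 1 := by
  rw [← star_eq_conjTranspose]
  exact Matrix.mem_unitaryGroup_iff.1 (Matrix.specialUnitaryGroup_le_unitaryGroup g.2)

/-- **The forward colour hop is a co-isometry**: `W_j W_jᴴ = 1` (a unitary colour rotation of the
block at the shifted site, flavour by flavour; `y ↦ y + ê_j` is injective on the three-torus, also
for `S = 1, 2`). -/
theorem colourHop_mul_conjTranspose (U : GaugeConfig 3 S (Matrix.specialUnitaryGroup (Fin 3) ℂ))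
    (j : Fin 3) : colourHop (Nf := Nf) U j * (colourHop U j)ᴴ = 1 := by
  ext ⟨f, y, a⟩ ⟨f', z, c⟩
  rw [mul_apply, Fintype.sum_prod_type, Finset.sum_eq_single_of_mem f (Finset.mem_univ _)]
  · rw [Fintype.sum_prod_type,
      Finset.sum_eq_single_of_mem (Site.shift y j) (Finset.mem_univ _)]
    · simp only [colourHop, of_apply, conjTranspose_apply, true_and, if_true]
      by_cases h : f' = f ∧ z = y
      · obtain ⟨rfl, rfl⟩ := h
        simp only [true_and, if_true]
        have h2 := congrFun (congrFun (link_mul_conjTranspose (U (z, j))) a) c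
        rw [mul_apply] at h2
        simp only [conjTranspose_apply] at h2
        rw [h2, one_apply, one_apply]
        by_cases hac : a = c
        · subst hac
          simp
        · rw [if_neg hac, if_neg fun hh => hac ?_]
          simpa using hh
      · have hc : ¬(f' = f ∧ Site.shift y j = Site.shift z j) := fun hh =>
          h ⟨hh.1, (add_right_cancel hh.2).symm⟩
        simp only [hc, if_false, star_zero, mul_zero, Finset.sum_const_zero]
        rw [one_apply, if_neg]
        intro hh
        simp only [Prod.mk.injEq] at hh
        exact h ⟨hh.1.symm, hh.2.1.symm⟩
    · intro w _ hw
      simp [colourHop, of_apply, hw]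
  · intro g _ hg
    simp [colourHop, of_apply, hg.symm]

/-- **The forward colour hop is an isometry**: `W_jᴴ W_j = 1`. -/
theorem conjTranspose_mul_colourHop (U : GaugeConfig 3 S (Matrix.specialUnitaryGroup (Fin 3) ℂ))
    (j : Fin 3) : (colourHop (Nf := Nf) U j)ᴴ * colourHop U j = 1 :=
  mul_eq_one_comm.1 (colourHop_mul_conjTranspose U j)

end Hops

end SliceMassHopPosDef

/-- **Positivity of Smit's `A(U)` = Lüscher's `B`** (stub `sliceMassHop_posDef` of line `Sketch`):
for every number of flavours `N_f`, every torus side `S ≥ 1`, every `SU(3)` background `U` on the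
spatial three-torus and all bare masses `m_f > −1` (`κ_f < 1/6`), the spin-blind slice operator
`sliceMassHop U mq = diag(m_f + 4) − ½ Σ_j (W_j + W_jᴴ)` is Hermitian positive definite
(`= diag(m_f + 1) + ½ Σ_j (1 − W_j)ᴴ(1 − W_j)` with isometric hops `W_j`).
[cite: Luscher1977, pp. 283–292]; [cite: MontvayMunster1994, §4.2.3 (4.111)]. -/
theorem sliceMassHop_posDef :
    ∀ (Nf S : ℕ) [NeZero S] (U : GaugeConfig 3 S (Matrix.specialUnitaryGroup (Fin 3) ℂ)) (mq : Fin Nf → ℝ),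
      (∀ f, -1 < mq f) → (sliceMassHop U mq).PosDef := by
  intro Nf S _ U mq hm
  unfold sliceMassHop
  exact SliceMassHopPosDef.posDef_diagonal_sub_hopSum (fun j => colourHop U j)
    (fun j => SliceMassHopPosDef.conjTranspose_mul_colourHop U j) (fun p => mq p.1 + 4)
    fun p => by
      show (Fintype.card (Fin 3) : ℝ) < mq p.1 + 4
      rw [Fintype.card_fin]
      push_cast
      linarith [hm p.1]

end Summit.QuantumFields.QCD.Cruxes.StableActionBridge.Sketch

end
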